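import Summits.KontsevichZagierPeriods.KontsevichZagierPeriods.Theorems.FurushoPentagonPentagonInKZCornerBoundsAux
import HarnessLib

/-!
# `PentagonInKZ`, line `edge-normal-newton-leibniz`: corner engine — bounds and vanishing
# orders of the dictionary integrands (stub `cornerEngine_bounds`)

Stub `cornerEngine_bounds` of the crux `PentagonInKZ` (stmt-KontsevichZagierPeriods-11348, route
FurushoPentagon), line `edge-normal-newton-leibniz`.  Pure real analysis on explicit rational
functions; no KZ objects are involved.

The corner engine works on the closed parameter rectangle `[0, α] × [0, β]` with the letter
densities `fd k t y = (cf k 1 + cf k 3 y) / φ_k(t, y)`, `gd k x s = (cf k 2 + cf k 3 x) / φ_k(x, s)`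
of the bilinear divisors `φ_k(x, y) = cf k 0 + cf k 1 x + cf k 2 y + cf k 3 x y` (letter `0` is
`φ₀ = x`, letter `1` is `φ₁ = y`, the others do not vanish on the rectangle), their common mixed
derivative `dd k x y = (cf k 0 cf k 3 - cf k 1 cf k 2) / φ_k(x, y)²`, and the dilated cubical
word integrands `qH u x ξ η = ∏ᵢ [u i = 0 ? 1/xᵢ : (ξ x₀⋯x_{i-1}) fd (u i) (ξ x₀⋯xᵢ) η]`
(horizontal side; `qV` is the vertical mirror image, letter `1`, `gd`) with explicit
`ξ`-derivative `dqH` (resp. `η`-derivative `dqV`).  The theorem `cornerEngine_bounds` provides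

1. LETTER LEVEL: one constant bounding `|fd k|` (`k ≠ 0`), `|gd k|` (`k ≠ 1`), `|dd k|` on the
   rectangle (continuity on a compact set, `CornerEngineBounds.ratio_bound`), the derivatives
   `∂_y fd k = dd k = ∂_x gd k` (quotient rule; constant functions for the letters `0`, `1`,
   junk value `1/0 = 0` included), and the resulting Lipschitz bounds in the transverse
   variables (mean value theorem on `[0, β]` resp. `[0, α]`);
2. WORD LEVEL (horizontal): for words whose LAST letter is not `0`, on the closed unit cube,
   one constant per length bounding `|qH|`, `|dqH|`, `|qH| / ξ` and
   `|qH(η) - qH(η')| / (ξ |η - η'|)` — the instance (letter `0`, `fd`) of the generic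
   `cornerEngine_wordBounds` (aux file `…CornerBoundsAux`), whose proof peels the outermost
   letter and compensates the factor `1/x₀` of a leading letter `0` by the abscissa `ξ x₀` of
   the tail;
3. the vertical mirror image: the instance (letter `1`, `φ k t p = gd k p t`, roles of `ξ`, `η`
   and of `α`, `β` exchanged) of the same generic statement.

References: M. Kontsevich, D. Zagier, *Periods* (2001), §1.2 (the calculus these estimates
serve); the estimates themselves are folklore calculus.
-/

noncomputable section

namespace Summit.KontsevichZagierPeriods.FurushoPentagon.PentagonInKZ

namespace CornerEngineBounds

/-! ### Letter level: bounded rational functions and the quotient rule -/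

/-- A ratio of continuous functions whose denominator does not vanish on the closed rectangle
`[0, α] × [0, β]` is bounded there. [folklore] -/
theorem ratio_bound (α β : ℝ) (P D : ℝ → ℝ → ℝ) (hP : Continuous fun q : ℝ × ℝ => P q.1 q.2)
    (hD : Continuous fun q : ℝ × ℝ => D q.1 q.2)
    (hD0 : ∀ x y : ℝ, 0 ≤ x → x ≤ α → 0 ≤ y → y ≤ β → D x y ≠ 0) :
    ∃ C, ∀ x y : ℝ, 0 ≤ x → x ≤ α → 0 ≤ y → y ≤ β → |P x y / D x y| ≤ C := by
  obtain ⟨C, hC⟩ := ((isCompact_Icc (a := (0 : ℝ)) (b := α)).prod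
      (isCompact_Icc (a := (0 : ℝ)) (b := β))).exists_bound_of_continuousOn
    (f := fun q : ℝ × ℝ => P q.1 q.2 / D q.1 q.2)
    (hP.continuousOn.div hD.continuousOn fun q hq => hD0 q.1 q.2 hq.1.1 hq.1.2 hq.2.1 hq.2.2)
  exact ⟨C, fun x y hx hx' hy hy' => by
    simpa only [Real.norm_eq_abs] using hC (x, y) ⟨⟨hx, hx'⟩, ⟨hy, hy'⟩⟩⟩

/-- Quotient rule in the second variable:
`∂_y [(b + d y) / (a + b ξ + c y + d ξ y)] = (a d - b c) / (a + b ξ + c y + d ξ y)²`. [folklore] -/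
theorem hasDerivAt_snd (a b c d ξ η : ℝ) (hD : a + b * ξ + c * η + d * ξ * η ≠ 0) :
    HasDerivAt (fun y => (b + d * y) / (a + b * ξ + c * y + d * ξ * y))
      ((a * d - b * c) / (a + b * ξ + c * η + d * ξ * η) ^ 2) η := by
  have hN : HasDerivAt (fun y => b + d * y) d η := (hasDerivAt_const_mul d).const_add b
  have hD' : HasDerivAt (fun y => a + b * ξ + c * y + d * ξ * y) (c + d * ξ) η :=
    ((hasDerivAt_const_mul c).const_add (a + b * ξ)).add (hasDerivAt_const_mul (d * ξ))
  refine (hN.div hD' hD).congr_deriv ?_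
  rw [div_left_inj' (pow_ne_zero 2 hD)]
  ring

/-- Quotient rule in the first variable:
`∂_x [(c + d x) / (a + b x + c η + d x η)] = (a d - b c) / (a + b x + c η + d x η)²`. [folklore] -/
theorem hasDerivAt_fst (a b c d ξ η : ℝ) (hD : a + b * ξ + c * η + d * ξ * η ≠ 0) :
    HasDerivAt (fun x => (c + d * x) / (a + b * x + c * η + d * x * η))
      ((a * d - b * c) / (a + b * ξ + c * η + d * ξ * η) ^ 2) ξ := by
  have hN : HasDerivAt (fun x => c + d * x) d ξ := (hasDerivAt_const_mul d).const_add c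
  have hD' : HasDerivAt (fun x => a + b * x + c * η + d * x * η) (b + d * η) ξ :=
    (((hasDerivAt_const_mul b).const_add a).add_const (c * η)).add
      ((hasDerivAt_const_mul d).mul_const η)
  refine (hN.div hD' hD).congr_deriv ?_
  rw [div_left_inj' (pow_ne_zero 2 hD)]
  ring

end CornerEngineBounds

/-- **Corner engine, bounds and vanishing orders** (stub `cornerEngine_bounds` of the line
`edge-normal-newton-leibniz`).  For the hypothesised dictionary of letter densities `fd`, `gd`
(with the regularised letters `cf 0 = (0,1,0,0)`, `cf 1 = (0,0,1,0)` and bilinear divisors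
non-vanishing on the closed rectangle `[0, α] × [0, β]` otherwise), their mixed derivative `dd`,
the dilated cubical word integrands `qH`, `qV` and their explicit derivatives `dqH`, `dqV`:
(1) one constant bounding `|fd k|` (`k ≠ 0`), `|gd k|` (`k ≠ 1`) and `|dd k|` on the rectangle,
the derivatives `∂_y fd k = dd k = ∂_x gd k`, and the Lipschitz bounds of `fd k` in `y` and of
`gd k` in `x`; (2) for every length one constant bounding, for words not ending with the letter
`0` and points of the closed unit cube, `|qH|`, `|dqH|`, `|qH| / ξ` and
`|qH(η) - qH(η')| / (ξ |η - η'|)`; (3) the mirror statement for `qV` (letter `1`, roles of `ξ`, `η`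
exchanged).  Continuity on compacta, the quotient rule and the mean value theorem at the letter
level; the two instances of `cornerEngine_wordBounds` at the word level.  These are the
domination inputs of the Newton–Leibniz moves of the calculus of periods
[cite: KontsevichZagier2001, §1.2]. -/
theorem cornerEngine_bounds :
    ∀ (m : ℕ) (cf : Fin (m + 2) → Fin 4 → ℚ) (α β : ℚ) (h0 : cf 0 = ![0, 1, 0, 0]) (h1 : cf 1 = ![0, 0, 1, 0]) (hreg : ∀ k : Fin (m + 2), k ≠ 0 → k ≠ 1 → ∀ x y : ℝ, 0 ≤ x → x ≤ (α : ℝ) → 0 ≤ y → y ≤ (β : ℝ) → (cf k 0 : ℝ) + (cf k 1 : ℝ) * x + (cf k 2 : ℝ) * y + (cf k 3 : ℝ) * x * y ≠ 0) (fd : Fin (m + 2) → ℝ → ℝ → ℝ) (hfd : ∀ k t y, fd k t y = ((cf k 1 : ℝ) + (cf k 3 : ℝ) * y) / ((cf k 0 : ℝ) + (cf k 1 : ℝ) * t + (cf k 2 : ℝ) * y + (cf k 3 : ℝ) * t * y)) (gd : Fin (m + 2) → ℝ → ℝ → ℝ) (hgd : ∀ k x s, gd k x s = ((cf k 2 : ℝ)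 + (cf k 3 : ℝ) * x) / ((cf k 0 : ℝ) + (cf k 1 : ℝ) * x + (cf k 2 : ℝ) * s + (cf k 3 : ℝ) * x * s)) (qH : ∀ {n : ℕ}, (Fin n → Fin (m + 2)) → (Fin n → ℝ) → ℝ → ℝ → ℝ) (hqH : ∀ {n : ℕ} (u : Fin n → Fin (m + 2)) (x : Fin n → ℝ) (ξ η : ℝ), qH u x ξ η = ∏ i, if u i = 0 then 1 / x i else (ξ * ∏ j ∈ Finset.univ.filter (fun j => j < i), x j) * fd (u i) (ξ * ∏ j ∈ Finset.univ.filter (fun j => j ≤ i), x j) η) (qV : ∀ {n : ℕ}, (Fin n → Fin (m + 2)) → (Fin n → ℝ) → ℝ → ℝ → ℝ) (hqV : ∀ {n : ℕ} (v : Fin n → Fin (m + 2)) (y : Fin n → ℝ) (ξ η : ℝ), qV v y ξ η = ∏ i, if v i = 1 then 1 / y i else (η * ∏ j ∈ Finset.univ.filter (fun j => j < i), y j) * gd (v i) ξ (η * ∏ j ∈ Finset.univ.filter (fun j => j ≤ i), y j)) (dqH : ∀ {n : ℕ}, (Fin n → Fin (m + 2)) → (Fin n → ℝ) → ℝ → ℝ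 → ℝ) (hdqH : ∀ {n : ℕ} (u : Fin n → Fin (m + 2)) (x : Fin n → ℝ) (ξ η : ℝ), dqH u x ξ η = ∑ j, (if u j = 0 then 0 else (∏ j' ∈ Finset.univ.filter (fun j' => j' < j), x j') * fd (u j) (ξ * ∏ j' ∈ Finset.univ.filter (fun j' => j' ≤ j), x j') η - (ξ * ∏ j' ∈ Finset.univ.filter (fun j' => j' < j), x j') * (∏ j' ∈ Finset.univ.filter (fun j' => j' ≤ j), x j') * (fd (u j) (ξ * ∏ j' ∈ Finset.univ.filter (fun j' => j' ≤ j), x j') η) ^ 2) * ∏ i ∈ Finset.univ.erase j, if u i = 0 then 1 / x i else (ξ * ∏ j' ∈ Finset.univ.filter (fun j' => j' < i), x j') * fd (u i) (ξ * ∏ j' ∈ Finset.univ.filter (fun j' => j' ≤ i), x j') η) (dqV : ∀ {n : ℕ}, (Fin n → Fin (m + 2)) → (Fin n → ℝ) → ℝ → ℝ → ℝ) (hdqV : ∀ {n : ℕ} (v : Fin n → Fin (m + 2)) (y : Fin n → ℝ) (ξ η : ℝ), dqV v y ξ η = ∑ j, (if v j = 1 then 0 else (∏ j' ∈ Finset.univ.filter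 (fun j' => j' < j), y j') * gd (v j) ξ (η * ∏ j' ∈ Finset.univ.filter (fun j' => j' ≤ j), y j') - (η * ∏ j' ∈ Finset.univ.filter (fun j' => j' < j), y j') * (∏ j' ∈ Finset.univ.filter (fun j' => j' ≤ j), y j') * (gd (v j) ξ (η * ∏ j' ∈ Finset.univ.filter (fun j' => j' ≤ j), y j')) ^ 2) * ∏ i ∈ Finset.univ.erase j, if v i = 1 then 1 / y i else (η * ∏ j' ∈ Finset.univ.filter (fun j' => j' < i), y j') * gd (v i) ξ (η * ∏ j' ∈ Finset.univ.filter (fun j' => j' ≤ i), y j')) (dd : Fin (m + 2) → ℝ → ℝ → ℝ), (∀ k x y, dd k x y = ((cf k 0 : ℝ) * (cf k 3 : ℝ) - (cf k 1 : ℝ) * (cf k 2 : ℝ)) / ((cf k 0 : ℝ) + (cf k 1 : ℝ) * x + (cf k 2 : ℝ) * y + (cf k 3 : ℝ) * x * y) ^ 2) → (∃ C : ℝ, ∀ (k : Fin (m + 2)) (ξ η : ℝ), 0 ≤ ξ → ξ ≤ (α : ℝ) → 0 ≤ η → η ≤ (β : ℝ) → (k ≠ 0 → |fd k ξ η| ≤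 C) ∧ (k ≠ 1 → |gd k ξ η| ≤ C) ∧ |dd k ξ η| ≤ C ∧ HasDerivAt (fun y => fd k ξ y) (dd k ξ η) η ∧ HasDerivAt (fun x => gd k x η) (dd k ξ η) ξ ∧ (∀ η' : ℝ, 0 ≤ η' → η' ≤ (β : ℝ) → |fd k ξ η - fd k ξ η'| ≤ C * |η - η'|) ∧ (∀ ξ' : ℝ, 0 ≤ ξ' → ξ' ≤ (α : ℝ) → |gd k ξ η - gd k ξ' η| ≤ C * |ξ - ξ'|)) ∧ (∀ n : ℕ, ∃ C : ℝ, ∀ (u : Fin n → Fin (m + 2)) (x : Fin n → ℝ) (ξ η : ℝ), (List.ofFn u).getLast? ≠ some 0 → (∀ i, 0 ≤ x i ∧ x i ≤ 1) → 0 ≤ ξ → ξ ≤ (α : ℝ) → 0 ≤ η → η ≤ (β : ℝ) → |qH u x ξ η| ≤ C ∧ |dqH u x ξ η| ≤ C ∧ (0 < n → |qH u x ξ η| ≤ C * ξ) ∧ (∀ η' : ℝ, 0 ≤ η' → η' ≤ (β : ℝ) → |qH u x ξ η - qH u x ξ η'| ≤ C * ξ * |η - η'|)) ∧ (∀ n :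 ℕ, ∃ C : ℝ, ∀ (v : Fin n → Fin (m + 2)) (y : Fin n → ℝ) (ξ η : ℝ), (List.ofFn v).getLast? ≠ some 1 → (∀ i, 0 ≤ y i ∧ y i ≤ 1) → 0 ≤ ξ → ξ ≤ (α : ℝ) → 0 ≤ η → η ≤ (β : ℝ) → |qV v y ξ η| ≤ C ∧ |dqV v y ξ η| ≤ C ∧ (0 < n → |qV v y ξ η| ≤ C * η) ∧ (∀ ξ' : ℝ, 0 ≤ ξ' → ξ' ≤ (α : ℝ) → |qV v y ξ η - qV v y ξ' η| ≤ C * η * |ξ - ξ'|)) := by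
  intro m cf α β h0 h1 hreg fd hfd gd hgd qH hqH qV hqV dqH hdqH dqV hdqV dd hdd
  -- (1a) letter bounds, letter by letter
  have hb : ∀ k : Fin (m + 2), ∃ C : ℝ, ∀ ξ η : ℝ, 0 ≤ ξ → ξ ≤ α → 0 ≤ η → η ≤ β →
      (k ≠ 0 → |fd k ξ η| ≤ C) ∧ (k ≠ 1 → |gd k ξ η| ≤ C) ∧ |dd k ξ η| ≤ C := by
    intro k
    by_cases hk0 : k = 0
    · subst hk0
      refine ⟨0, fun ξ η _ _ _ _ => ⟨fun h => absurd rfl h, fun _ => ?_, ?_⟩⟩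
      · rw [hgd]; simp [h0]
      · rw [hdd]; simp [h0]
    by_cases hk1 : k = 1
    · subst hk1
      refine ⟨0, fun ξ η _ _ _ _ => ⟨fun _ => ?_, fun h => absurd rfl h, ?_⟩⟩
      · rw [hfd]; simp [h1]
      · rw [hdd]; simp [h1]
    obtain ⟨C₁, hC₁⟩ := CornerEngineBounds.ratio_bound α β
      (fun _ y => (cf k 1 : ℝ) + (cf k 3 : ℝ) * y)
      (fun x y => (cf k 0 : ℝ) + (cf k 1 : ℝ) * x + (cf k 2 : ℝ) * y + (cf k 3 : ℝ) * x * y)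
      (by fun_prop) (by fun_prop) (hreg k hk0 hk1)
    obtain ⟨C₂, hC₂⟩ := CornerEngineBounds.ratio_bound α β
      (fun x _ => (cf k 2 : ℝ) + (cf k 3 : ℝ) * x)
      (fun x y => (cf k 0 : ℝ) + (cf k 1 : ℝ) * x + (cf k 2 : ℝ) * y + (cf k 3 : ℝ) * x * y)
      (by fun_prop) (by fun_prop) (hreg k hk0 hk1)
    obtain ⟨C₃, hC₃⟩ := CornerEngineBounds.ratio_bound α β
      (fun _ _ => (cf k 0 : ℝ) * (cf k 3 : ℝ) - (cf k 1 : ℝ) * (cf k 2 : ℝ))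
      (fun x y => ((cf k 0 : ℝ) + (cf k 1 : ℝ) * x + (cf k 2 : ℝ) * y + (cf k 3 : ℝ) * x * y) ^ 2)
      (by fun_prop) (by fun_prop)
      (fun x y h₁ h₂ h₃ h₄ => pow_ne_zero 2 (hreg k hk0 hk1 x y h₁ h₂ h₃ h₄))
    refine ⟨max C₁ (max C₂ C₃), fun ξ η h₁ h₂ h₃ h₄ => ⟨fun _ => ?_, fun _ => ?_, ?_⟩⟩
    · rw [hfd]; exact (hC₁ ξ η h₁ h₂ h₃ h₄).trans (le_max_left _ _)
    · rw [hgd]; exact (hC₂ ξ η h₁ h₂ h₃ h₄).trans ((le_max_left _ _).trans (le_max_right _ _))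
    · rw [hdd]; exact (hC₃ ξ η h₁ h₂ h₃ h₄).trans ((le_max_right _ _).trans (le_max_right _ _))
  choose Cb hCb using hb
  -- one constant for all letters
  set C₀ : ℝ := ∑ k, |Cb k| with hC₀
  have hC₀k : ∀ k, Cb k ≤ C₀ := fun k => (le_abs_self _).trans
    (Finset.single_le_sum (f := fun k => |Cb k|) (fun i _ => abs_nonneg _) (Finset.mem_univ k))
  have hC₀0 : 0 ≤ C₀ := Finset.sum_nonneg fun i _ => abs_nonneg _
  have hfdb : ∀ k : Fin (m + 2), k ≠ 0 → ∀ t p : ℝ, 0 ≤ t → t ≤ α → 0 ≤ p → p ≤ β →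
      |fd k t p| ≤ C₀ :=
    fun k hk t p h₁ h₂ h₃ h₄ => ((hCb k t p h₁ h₂ h₃ h₄).1 hk).trans (hC₀k k)
  have hgdb : ∀ k : Fin (m + 2), k ≠ 1 → ∀ t p : ℝ, 0 ≤ t → t ≤ β → 0 ≤ p → p ≤ α →
      |gd k p t| ≤ C₀ :=
    fun k hk t p h₁ h₂ h₃ h₄ => ((hCb k p t h₃ h₄ h₁ h₂).2.1 hk).trans (hC₀k k)
  have hddb : ∀ (k : Fin (m + 2)) (ξ η : ℝ), 0 ≤ ξ → ξ ≤ α → 0 ≤ η → η ≤ β →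
      |dd k ξ η| ≤ C₀ :=
    fun k ξ η h₁ h₂ h₃ h₄ => (hCb k ξ η h₁ h₂ h₃ h₄).2.2.trans (hC₀k k)
  -- (1b) the derivatives `∂_y fd = dd = ∂_x gd`
  have hder : ∀ (k : Fin (m + 2)) (ξ η : ℝ), 0 ≤ ξ → ξ ≤ α → 0 ≤ η → η ≤ β →
      HasDerivAt (fun y => fd k ξ y) (dd k ξ η) η ∧
        HasDerivAt (fun x => gd k x η) (dd k ξ η) ξ := by
    intro k ξ η h₁ h₂ h₃ h₄
    by_cases hk0 : k = 0
    · subst hk0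
      have e1 : (fun y => fd 0 ξ y) = fun _ => 1 / ξ := funext fun y => by rw [hfd]; simp [h0]
      have e2 : (fun x => gd 0 x η) = fun _ => (0 : ℝ) := funext fun x => by rw [hgd]; simp [h0]
      have e3 : dd 0 ξ η = 0 := by rw [hdd]; simp [h0]
      rw [e1, e2, e3]
      exact ⟨hasDerivAt_const _ _, hasDerivAt_const _ _⟩
    by_cases hk1 : k = 1
    · subst hk1
      have e1 : (fun y => fd 1 ξ y) = fun _ => (0 : ℝ) := funext fun y => by rw [hfd]; simp [h1]
      have e2 : (fun x => gd 1 x η) = fun _ => 1 / η := funext fun x => by rw [hgd]; simp [h1]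
      have e3 : dd 1 ξ η = 0 := by rw [hdd]; simp [h1]
      rw [e1, e2, e3]
      exact ⟨hasDerivAt_const _ _, hasDerivAt_const _ _⟩
    simp only [hfd, hgd, hdd]
    exact ⟨CornerEngineBounds.hasDerivAt_snd _ _ _ _ ξ η (hreg k hk0 hk1 ξ η h₁ h₂ h₃ h₄),
      CornerEngineBounds.hasDerivAt_fst _ _ _ _ ξ η (hreg k hk0 hk1 ξ η h₁ h₂ h₃ h₄)⟩
  -- (1c) the Lipschitz bounds (mean value theorem)
  have hlipf : ∀ (k : Fin (m + 2)) (ξ η η' : ℝ), 0 ≤ ξ → ξ ≤ α → 0 ≤ η → η ≤ β → 0 ≤ η' →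
      η' ≤ β → |fd k ξ η - fd k ξ η'| ≤ C₀ * |η - η'| := by
    intro k ξ η η' h₁ h₂ h₃ h₄ h₅ h₆
    have key := Convex.norm_image_sub_le_of_norm_hasDerivWithin_le
      (f := fun y => fd k ξ y) (f' := fun y => dd k ξ y) (s := Set.Icc 0 (β : ℝ)) (x := η')
      (y := η) (fun y hy => (hder k ξ y h₁ h₂ hy.1 hy.2).1.hasDerivWithinAt)
      (fun y hy => by simpa only [Real.norm_eq_abs] using hddb k ξ y h₁ h₂ hy.1 hy.2)
      (convex_Icc _ _) ⟨h₅, h₆⟩ ⟨h₃, h₄⟩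
    simpa only [Real.norm_eq_abs] using key
  have hlipg : ∀ (k : Fin (m + 2)) (η ξ ξ' : ℝ), 0 ≤ η → η ≤ β → 0 ≤ ξ → ξ ≤ α → 0 ≤ ξ' →
      ξ' ≤ α → |gd k ξ η - gd k ξ' η| ≤ C₀ * |ξ - ξ'| := by
    intro k η ξ ξ' h₃ h₄ h₁ h₂ h₅ h₆
    have key := Convex.norm_image_sub_le_of_norm_hasDerivWithin_le
      (f := fun x => gd k x η) (f' := fun x => dd k x η) (s := Set.Icc 0 (α : ℝ)) (x := ξ')
      (y := ξ) (fun x hx => (hder k x η hx.1 hx.2 h₃ h₄).2.hasDerivWithinAt)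
      (fun x hx => by simpa only [Real.norm_eq_abs] using hddb k x η hx.1 hx.2 h₃ h₄)
      (convex_Icc _ _) ⟨h₅, h₆⟩ ⟨h₁, h₂⟩
    simpa only [Real.norm_eq_abs] using key
  refine ⟨⟨C₀, fun k ξ η h₁ h₂ h₃ h₄ => ⟨fun hk => hfdb k hk ξ η h₁ h₂ h₃ h₄,
    fun hk => hgdb k hk η ξ h₃ h₄ h₁ h₂, hddb k ξ η h₁ h₂ h₃ h₄, (hder k ξ η h₁ h₂ h₃ h₄).1,
    (hder k ξ η h₁ h₂ h₃ h₄).2, fun η' h₅ h₆ => hlipf k ξ η η' h₁ h₂ h₃ h₄ h₅ h₆,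
    fun ξ' h₅ h₆ => hlipg k η ξ ξ' h₃ h₄ h₁ h₂ h₅ h₆⟩⟩, fun n => ?_, fun n => ?_⟩
  · -- (2) horizontal words: letter `0`, density `fd`
    obtain ⟨C, _, hC⟩ := cornerEngine_wordBounds (0 : Fin (m + 2)) fd α β C₀ hC₀0 hfdb
      hlipf qH hqH dqH hdqH n
    exact ⟨C, hC⟩
  · -- (3) vertical words: letter `1`, density `gd` with the roles of the variables exchanged
    obtain ⟨C, _, hC⟩ := cornerEngine_wordBounds (1 : Fin (m + 2)) (fun k t p => gd k p t)
      β α C₀ hC₀0 hgdb hlipg (fun {n} v y η ξ => qV v y ξ η) (fun v y η ξ => hqV v y ξ η)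
      (fun {n} v y η ξ => dqV v y ξ η) (fun v y η ξ => hdqV v y ξ η) n
    exact ⟨C, fun v y ξ η hv hy h₁ h₂ h₃ h₄ => hC v y η ξ hv hy h₃ h₄ h₁ h₂⟩

end Summit.KontsevichZagierPeriods.FurushoPentagon.PentagonInKZ
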